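import Summits.Ventures.CertifiedManyBodySolver.Observables.PhaseSeparationExclusionBoxThermalHotAnchor
import Summits.Ventures.CertifiedManyBodySolver.Observables.PhaseSeparationExclusionBox
import Literature.MathematicalPhysics.QuantumLattice.HubbardTTPrimeThermalPressureLocalMomentCeiling
import Mathlib.Analysis.Complex.ExponentialBounds
import HarnessLib

/-!
# Ventures/CertifiedManyBodySolver — Observables/PhaseSeparationExclusionBoxThermalDoccAnchor.lean: the DENSE partner's `T > 0` anchor is the
# MOTT (local-moment) entropy `log(2 + 2q) − (n₂ − 2D)·log q` with the thermal double occupancy `D` capped by a LAGGED `T = 0` FLOOR —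
# column × threshold forms with NO thermal claim node

HONEST FRAMING: a transport device for the hot-anchored competing-order words of this seat (`Observables/PhaseSeparationExclusionBoxThermalHotAnchor.lean` g20,
`…BoxThermalFreeDilute.lean` g25): EXCLUSION of MACROSCOPIC PHASE COEXISTENCE (a phase of density `≤ n₁` with a phase of density `≥ n₂`) in CANONICAL THERMAL
torus-limit states on a `(t′, U)` cell, for every `β ≥ β₀`; CONTROL class; conditional on the rows an instance names; nothing about stripes, about which phase is
realised, or about superconductivity; no number of record. Zero compute, no definition, no claim node.

THE DEVICE (filling lane, g32). Every `T > 0` word so far carried for the DENSE density `n₂` (`= 1` in all instances) the A-PRIORI anchor `p(0; ·; n₂) ≤ 2 H_b(n₂/2)`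
(`2 log 2 = 1.386` at half filling): `≥ 80 %` of the numerator `K` of the threshold `β₀ = K/M`. The local-moment entropy ceiling of
`Literature/…/HubbardTTPrimeThermalPressureLocalMomentCeiling.lean` (this seat, g32) replaces it by `log(2 + 2q) − log q·(n₂ − 2D)` where `D` is the thermal double
occupancy of the dense phase, and the `U`-CHORD against a `T = 0` floor ONE LAG `Δ` TO THE LEFT, `Δ·D ≤ e_U − floor(U − Δ)`, caps `D` with NO thermal input: on a
cell whose two `n₂`-columns `L₁, L₂` (at `U₁, U₂`) come with two LAGGED columns `G₁, G₂` (floors at `U₁ − Δ`, `U₂ − Δ`; chords in between by concavity in `U`),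
for every `(s, U)` in the cell and `β_h ≥ C₁ ≥ 2 log q/Δ` (§1, `doccAnchor_on_cell`):

  `p(β_h; t,s,U; n₂) ≤ C₀ + C₁·(F₂(s,U) − G(s,U−Δ)) − β_h·F₂(s,U)`,  `C₀ ≥ log(2+2q) − n₂ log q`,

so that in the anchored inequality of the law the dense bracket `b·(Q₂ + β_h F₂)` becomes `b·(C₀ + C₁·(L_i − G_i))` on column `i` — AFFINE in `U` between the
columns (same chord weights), hence the COLUMN × THRESHOLD form (§2, `psT_not_thermal_mix_on_cell_of_columns_doccAnchor_tcap`) and the ABOVE-COLUMN form (§3,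
`psT_not_thermal_mix_above_column_doccAnchor_tcap`, lagged column `U_l < U₂`, slope only decreasing in `U`) are proved exactly as the g25 forms from
`psT_not_thermal_mix_on_cell_of_fns_hotAnchorFn`. With `q ∈ {2, 3, 4, 5, 9, 15}` only Mathlib's `log 2 / log 3 / log 5` enclosures enter (§0, one lemma per `q`:
`doccWitness_q*`). SIZE OF THE EFFECT (estimator over the g31 cell tables): at half filling the chord slope `(L_i − G_i)/Δ` of the tree's `n = 1` laws is
`0.00–0.07` for `U ≥ 7` (`⇒` dense constant `0.76–1.10` instead of `1.386`, thresholds `−25…−45 %`) and `≈ 0.12` at `U ≤ 5` where the lagged floor is a kinematic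
carry (`−5…−10 %`).

Cell `pub/hubbard-downfold` (MO-S1 ↔ S2 seam «box ↦ one word»; D-0096 (ii)+(iii), `T` axis of the D-0098 map), seat `hubbard-downfold-unc-2` (g32).
References: R. B. Israel, *Convexity in the Theory of Lattice Gases* (1979) Lemma II.3.1 / Thm I.2.4 [Israel1979]; E. H. Lieb, CMP 31 (1973) 327 §V [Lieb1973];
D. Poulin, M. B. Hastings, PRL 106 (2011) 080403 [PoulinHastings2011]; R. B. Griffiths, J. Math. Phys. 5 (1964) 1215 §II [Griffiths1966]; D. Ruelle,
*Statistical Mechanics* (1969) §3.3 [Ruelle1969].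
-/

noncomputable section

namespace Summit.Ventures.CertifiedManyBodySolver.Observables

open Literature.MathematicalPhysics.QuantumLattice Literature.MathematicalPhysics.QuantumLattice.ThermodynamicLimit
open Literature.MathematicalPhysics.QuantumLattice.InfVolFermionState Set Filter

/-! ## §0 The witness table: `log(2 + 2q)` from above, `log q` from both sides, `q ∈ {2, 3, 4, 5, 9, 15}` (Mathlib's d9 enclosures) -/

/-- `q = 2`: `log 6 ≤ 1.7917594696`, `0.6931471803 ≤ log 2 ≤ 0.6931471808`. [cite: Israel1979, Lemma II.3.1] -/
theorem doccWitness_q2 : Real.log (2 + 2 * (2 : ℝ)) ≤ 17917594696 / 10 ^ 10 ∧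
    (6931471803 / 10 ^ 10 : ℝ) ≤ Real.log 2 ∧ Real.log 2 ≤ 6931471808 / 10 ^ 10 := by
  have h2 := Real.log_two_lt_d9; have h2' := Real.log_two_gt_d9; have h3 := Real.log_three_lt_d9
  have e : Real.log (2 + 2 * (2 : ℝ)) = Real.log 2 + Real.log 3 := by
    rw [show (2 + 2 * (2 : ℝ)) = 2 * 3 by norm_num, Real.log_mul (by norm_num) (by norm_num)]
  refine ⟨?_, ?_, ?_⟩ <;> norm_num at * <;> linarith

/-- `q = 3`: `log 8 ≤ 2.0794415424`, `1.0986122885 ≤ log 3 ≤ 1.0986122888`. [cite: Israel1979, Lemma II.3.1] -/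
theorem doccWitness_q3 : Real.log (2 + 2 * (3 : ℝ)) ≤ 20794415424 / 10 ^ 10 ∧
    (10986122885 / 10 ^ 10 : ℝ) ≤ Real.log 3 ∧ Real.log 3 ≤ 10986122888 / 10 ^ 10 := by
  have h2 := Real.log_two_lt_d9; have h3 := Real.log_three_lt_d9; have h3' := Real.log_three_gt_d9
  have e : Real.log (2 + 2 * (3 : ℝ)) = 3 * Real.log 2 := by
    rw [show (2 + 2 * (3 : ℝ)) = 2 ^ 3 by norm_num, Real.log_pow]; norm_num
  refine ⟨?_, ?_, ?_⟩ <;> norm_num at * <;> linarith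

/-- `q = 4`: `log 10 ≤ 2.3025850934`, `1.3862943606 ≤ log 4 ≤ 1.3862943616`. [cite: Israel1979, Lemma II.3.1] -/
theorem doccWitness_q4 : Real.log (2 + 2 * (4 : ℝ)) ≤ 23025850934 / 10 ^ 10 ∧
    (13862943606 / 10 ^ 10 : ℝ) ≤ Real.log 4 ∧ Real.log 4 ≤ 13862943616 / 10 ^ 10 := by
  have h2 := Real.log_two_lt_d9; have h2' := Real.log_two_gt_d9; have h5 := Real.log_five_lt_d9
  have e : Real.log (2 + 2 * (4 : ℝ)) = Real.log 2 + Real.log 5 := by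
    rw [show (2 + 2 * (4 : ℝ)) = 2 * 5 by norm_num, Real.log_mul (by norm_num) (by norm_num)]
  have e4 : Real.log (4 : ℝ) = 2 * Real.log 2 := by
    rw [show (4 : ℝ) = 2 ^ 2 by norm_num, Real.log_pow]; norm_num
  refine ⟨?_, ?_, ?_⟩ <;> norm_num at * <;> linarith

/-- `q = 5`: `log 12 ≤ 2.4849066504`, `1.6094379123 ≤ log 5 ≤ 1.6094379126`. [cite: Israel1979, Lemma II.3.1] -/
theorem doccWitness_q5 : Real.log (2 + 2 * (5 : ℝ)) ≤ 24849066504 / 10 ^ 10 ∧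
    (16094379123 / 10 ^ 10 : ℝ) ≤ Real.log 5 ∧ Real.log 5 ≤ 16094379126 / 10 ^ 10 := by
  have h2 := Real.log_two_lt_d9; have h3 := Real.log_three_lt_d9; have h5 := Real.log_five_lt_d9; have h5' := Real.log_five_gt_d9
  have e : Real.log (2 + 2 * (5 : ℝ)) = 2 * Real.log 2 + Real.log 3 := by
    rw [show (2 + 2 * (5 : ℝ)) = 2 ^ 2 * 3 by norm_num, Real.log_mul (by norm_num) (by norm_num), Real.log_pow]; norm_num
  refine ⟨?_, ?_, ?_⟩ <;> norm_num at * <;> linarith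

/-- `q = 9`: `log 20 ≤ 2.9957322742`, `2.197224577 ≤ log 9 ≤ 2.1972245776`. [cite: Israel1979, Lemma II.3.1] -/
theorem doccWitness_q9 : Real.log (2 + 2 * (9 : ℝ)) ≤ 29957322742 / 10 ^ 10 ∧
    (21972245770 / 10 ^ 10 : ℝ) ≤ Real.log 9 ∧ Real.log 9 ≤ 21972245776 / 10 ^ 10 := by
  have h2 := Real.log_two_lt_d9; have h3 := Real.log_three_lt_d9; have h3' := Real.log_three_gt_d9; have h5 := Real.log_five_lt_d9
  have e : Real.log (2 + 2 * (9 : ℝ)) = 2 * Real.log 2 + Real.log 5 := by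
    rw [show (2 + 2 * (9 : ℝ)) = 2 ^ 2 * 5 by norm_num, Real.log_mul (by norm_num) (by norm_num), Real.log_pow]; norm_num
  have e9 : Real.log (9 : ℝ) = 2 * Real.log 3 := by
    rw [show (9 : ℝ) = 3 ^ 2 by norm_num, Real.log_pow]; norm_num
  refine ⟨?_, ?_, ?_⟩ <;> norm_num at * <;> linarith

/-- `q = 15`: `log 32 ≤ 3.465735904`, `2.7080502008 ≤ log 15 ≤ 2.7080502014`. [cite: Israel1979, Lemma II.3.1] -/
theorem doccWitness_q15 : Real.log (2 + 2 * (15 : ℝ)) ≤ 34657359040 / 10 ^ 10 ∧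
    (27080502008 / 10 ^ 10 : ℝ) ≤ Real.log 15 ∧ Real.log 15 ≤ 27080502014 / 10 ^ 10 := by
  have h2 := Real.log_two_lt_d9; have h3 := Real.log_three_lt_d9; have h3' := Real.log_three_gt_d9
  have h5 := Real.log_five_lt_d9; have h5' := Real.log_five_gt_d9
  have e : Real.log (2 + 2 * (15 : ℝ)) = 5 * Real.log 2 := by
    rw [show (2 + 2 * (15 : ℝ)) = 2 ^ 5 by norm_num, Real.log_pow]; norm_num
  have e15 : Real.log (15 : ℝ) = Real.log 3 + Real.log 5 := by
    rw [show (15 : ℝ) = 3 * 5 by norm_num, Real.log_mul (by norm_num) (by norm_num)]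
  refine ⟨?_, ?_, ?_⟩ <;> norm_num at * <;> linarith

/-! ## §1 The dense anchor on a cell from two column laws and two lagged column laws -/

/-- **THE MOTT ANCHOR ON A CELL.** `t` arbitrary, cell `[s₁, s₂] × [U₁, U₂]` (`U₁ < U₂`), lag `Δ > 0` with `U₁ − Δ ≥ 0`, density `0 < n₂ < 2`, witness `q > 1`,
constants `C₀ ≥ log(2 + 2q) − n₂ log q`, `C₁ ≥ 2 log q/Δ`, hot inverse temperature `β_h ≥ C₁`; column laws `L_i(s) ≤ e(t, s, U_i, n₂)`, LAGGED column laws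
`G_i(s) ≤ e(t, s, U_i − Δ, n₂)` with `G_i ≤ L_i` on `[s₁, s₂]`. Then for every `(s, U)` in the cell, with the `U`-chords `F₂(s,U) = ((U₂−U)L₁ + (U−U₁)L₂)/(U₂−U₁)`,
`G(s,U−Δ) = ((U₂−U)G₁ + (U−U₁)G₂)/(U₂−U₁)`:  `p(β_h; t,s,U; n₂) ≤ C₀ + C₁·(F₂ − G) − β_h·F₂`.
[cite: Israel1979, Lemma II.3.1] [cite: Lieb1973, §V (5.2)–(5.4)] [cite: Griffiths1966, §II] -/
theorem doccAnchor_on_cell (t : ℝ) {s₁ s₂ U₁ U₂ Δ n₂ βh q C₀ C₁ : ℝ} {L₁ L₂ G₁ G₂ : ℝ → ℝ}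
    (hΔ : 0 < Δ) (hU₁Δ : 0 ≤ U₁ - Δ) (h12 : U₁ < U₂) (hn0 : 0 < n₂) (hn2 : n₂ < 2) (hq : 1 < q)
    (hC₀ : Real.log (2 + 2 * q) - Real.log q * n₂ ≤ C₀) (hC₁ : 2 * Real.log q / Δ ≤ C₁) (hβh : C₁ ≤ βh)
    (hL₁ : ∀ s ∈ Icc s₁ s₂, L₁ s ≤ energyDensityTT' t s U₁ n₂) (hL₂ : ∀ s ∈ Icc s₁ s₂, L₂ s ≤ energyDensityTT' t s U₂ n₂)
    (hG₁ : ∀ s ∈ Icc s₁ s₂, G₁ s ≤ energyDensityTT' t s (U₁ - Δ) n₂) (hG₂ : ∀ s ∈ Icc s₁ s₂, G₂ s ≤ energyDensityTT' t s (U₂ - Δ) n₂)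
    (hLG₁ : ∀ s ∈ Icc s₁ s₂, G₁ s ≤ L₁ s) (hLG₂ : ∀ s ∈ Icc s₁ s₂, G₂ s ≤ L₂ s) :
    ∀ s ∈ Icc s₁ s₂, ∀ U ∈ Icc U₁ U₂, pressureTT' βh t s U n₂ ≤
      C₀ + C₁ * (((U₂ - U) * L₁ s + (U - U₁) * L₂ s) / (U₂ - U₁) - ((U₂ - U) * G₁ s + (U - U₁) * G₂ s) / (U₂ - U₁)) -
        βh * (((U₂ - U) * L₁ s + (U - U₁) * L₂ s) / (U₂ - U₁)) := by
  intro s hs U hU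
  have hq0 : 0 < q := zero_lt_one.trans hq
  have hκ : 0 < Real.log q := Real.log_pos hq
  have hC₁pos : 0 < C₁ := lt_of_lt_of_le (div_pos (by linarith) hΔ) hC₁
  have hβpos : 0 < βh := hC₁pos.trans_le hβh
  have hd : 0 < U₂ - U₁ := sub_pos.2 h12
  -- the two floors at U and at U - Δ (chords by concavity in U)
  have hF := floor_on_cell_of_columnLaws t hn0.le hn2 (hU₁Δ.trans (by linarith)) h12 hL₁ hL₂ s hs U hU
  have h12' : U₁ - Δ < U₂ - Δ := by linarith
  have hUΔ : U - Δ ∈ Icc (U₁ - Δ) (U₂ - Δ) := ⟨by linarith [hU.1], by linarith [hU.2]⟩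
  have hG := floor_on_cell_of_columnLaws t hn0.le hn2 hU₁Δ h12' hG₁ hG₂ s hs (U - Δ) hUΔ
  have hGid : ((U₂ - Δ - (U - Δ)) * G₁ s + (U - Δ - (U₁ - Δ)) * G₂ s) / (U₂ - Δ - (U₁ - Δ)) =
      ((U₂ - U) * G₁ s + (U - U₁) * G₂ s) / (U₂ - U₁) := by
    congr 1 <;> ring
  rw [hGid] at hG
  -- the Literature ceiling with κ = log q, U_l = U - Δ
  have hmain := pressureTT'_le_localMoment_of_floors t s (Ul := U - Δ) (κ := Real.log q) (by linarith [hU.1]) (by linarith) hn0 hn2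
    hβpos hκ.le (by
      have : 2 * Real.log q ≤ C₁ * Δ := by rwa [div_le_iff₀ hΔ] at hC₁
      have : U - (U - Δ) = Δ := by ring
      rw [this]; nlinarith) hF hG
  rw [Real.exp_log hq0, show U - (U - Δ) = Δ by ring] at hmain
  -- the difference of the chords is ≥ 0
  have hdiff : 0 ≤ ((U₂ - U) * L₁ s + (U - U₁) * L₂ s) / (U₂ - U₁) - ((U₂ - U) * G₁ s + (U - U₁) * G₂ s) / (U₂ - U₁) := by
    rw [← sub_div]
    apply div_nonneg _ hd.le
    have k1 := mul_le_mul_of_nonneg_left (hLG₁ s hs) (sub_nonneg.2 hU.2)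
    have k2 := mul_le_mul_of_nonneg_left (hLG₂ s hs) (sub_nonneg.2 hU.1)
    linarith
  set X := ((U₂ - U) * L₁ s + (U - U₁) * L₂ s) / (U₂ - U₁) - ((U₂ - U) * G₁ s + (U - U₁) * G₂ s) / (U₂ - U₁) with hX
  have hC₁X : 2 * Real.log q * X / Δ ≤ C₁ * X := by
    rw [mul_div_right_comm]
    exact mul_le_mul_of_nonneg_right hC₁ hdiff
  have e1 : 2 * Real.log q * (((U₂ - U) * L₁ s + (U - U₁) * L₂ s) / (U₂ - U₁) - ((U₂ - U) * G₁ s + (U - U₁) * G₂ s) / (U₂ - U₁)) / Δ =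
      2 * Real.log q * X / Δ := by rw [hX]
  rw [e1] at hmain
  linarith

/-- **THE MOTT ANCHOR ABOVE A COLUMN.** Column law `L(s) ≤ e(t, s, U₂, n₂)` (floor for every `U ≥ U₂`), lagged column `G(s) ≤ e(t, s, U_l, n₂)` with `0 ≤ U_l < U₂`,
`G ≤ L`; `C₀ ≥ log(2+2q) − n₂ log q`, `C₁ ≥ 2 log q/(U₂ − U_l)`, `β_h ≥ C₁`. Then for every `s ∈ [s₁, s₂]` and every `U ≥ U₂`:
`p(β_h; t,s,U; n₂) ≤ C₀ + C₁·(L − G) − β_h·L`. [cite: Israel1979, Lemma II.3.1] [cite: Lieb1973, §V (5.2)–(5.4)] [cite: Griffiths1966, §II] -/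
theorem doccAnchor_above_column (t : ℝ) {s₁ s₂ U₂ U₃ Ul n₂ βh q C₀ C₁ : ℝ} {L G : ℝ → ℝ}
    (hUl : 0 ≤ Ul) (hUl₂ : Ul < U₂) (hn0 : 0 < n₂) (hn2 : n₂ < 2) (hq : 1 < q)
    (hC₀ : Real.log (2 + 2 * q) - Real.log q * n₂ ≤ C₀) (hC₁ : 2 * Real.log q / (U₂ - Ul) ≤ C₁) (hβh : C₁ ≤ βh)
    (hL : ∀ s ∈ Icc s₁ s₂, L s ≤ energyDensityTT' t s U₂ n₂) (hG : ∀ s ∈ Icc s₁ s₂, G s ≤ energyDensityTT' t s Ul n₂)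
    (hLG : ∀ s ∈ Icc s₁ s₂, G s ≤ L s) :
    ∀ s ∈ Icc s₁ s₂, ∀ U ∈ Icc U₂ U₃, pressureTT' βh t s U n₂ ≤ C₀ + C₁ * (L s - G s) - βh * L s := by
  intro s hs U hU
  have hq0 : 0 < q := zero_lt_one.trans hq
  have hκ : 0 < Real.log q := Real.log_pos hq
  have hd : 0 < U₂ - Ul := sub_pos.2 hUl₂
  have hC₁pos : 0 < C₁ := lt_of_lt_of_le (div_pos (by linarith) hd) hC₁
  have hβpos : 0 < βh := hC₁pos.trans_le hβh
  have hmain := pressureTT'_le_localMoment_above_column t s (κ := Real.log q) hUl hUl₂ hU.1 hn0 hn2 hβpos hκ.le (by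
      have : 2 * Real.log q ≤ C₁ * (U₂ - Ul) := by rwa [div_le_iff₀ hd] at hC₁
      nlinarith) (hL s hs) (hG s hs) (hLG s hs)
  rw [Real.exp_log hq0] at hmain
  have hC₁X : 2 * Real.log q * (L s - G s) / (U₂ - Ul) ≤ C₁ * (L s - G s) := by
    rw [mul_div_right_comm]
    exact mul_le_mul_of_nonneg_right hC₁ (sub_nonneg.2 (hLG s hs))
  linarith

/-! ## §2 Column × threshold form with the Mott anchor for the dense partner -/

/-- **COLUMN × THRESHOLD FORM, MOTT-ANCHORED DENSE PARTNER, `s`-DEPENDENT DILUTE ANCHOR `Q₁(s)`, CAP AFFINE IN `(s, U)`.** Cell `[s₁, s₂] × [U₁, U₂]`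
(`U₁ < U₂`, lag `Δ > 0`, `U₁ − Δ ≥ 0`), `0 ≤ n₁ < n₂ < 2`, weights `a + b = 1`; cap `e(t, s, U, a n₁ + b n₂) ≤ c₀ + c_s·s + c₁·U` on the cell; column laws `L_i(s) ≤ e(t, s, U_i, n₂)`
and LAGGED column laws `G_i(s) ≤ e(t, s, U_i − Δ, n₂)` with `G_i ≤ L_i`; dilute floor `F₁(s)` and dilute anchor `p(β_{h,1}; n₁) ≤ Q₁(s)` (`0 ≤ β_{h,1} ≤ β₀`); witness
`q > 1` with `C₀ ≥ log(2+2q) − n₂ log q`, `C₁ ≥ 2 log q/Δ`, `C₁ ≤ β_{h,2} ≤ β₀ ≤ β`; on BOTH columns the `T = 0` margin is `≥ 0` and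
`a Q₁(s) + β_{h,1} a F₁(s) + b (C₀ + C₁ (L_i(s) − G_i(s))) < β₀·(a F₁(s) + b L_i(s) − (c₀ + c_s s + c₁ U_i))` (affine in `s`: two checks per column). Then the
`(≤ n₁ | ≥ n₂)` coexistence is excluded in every canonical thermal state at `(β; t, s, U; n)` on the cell.
[cite: Israel1979, Thm. I.2.4] [cite: PoulinHastings2011, eqs. (3)–(8)] [cite: Lieb1973, §V (5.2)–(5.4)] [cite: Ruelle1969, §3.3] -/
theorem psT_not_thermal_mix_on_cell_of_columns_doccAnchor_tcap (t : ℝ)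
    {s₁ s₂ U₁ U₂ Δ n₁ n₂ a b c₀ cs c₁ β β₀ βh₁ βh₂ q C₀ C₁ : ℝ}
    (hΔ : 0 < Δ) (hU₁Δ : 0 ≤ U₁ - Δ) (h12 : U₁ < U₂) (hn₁ : 0 ≤ n₁) (hn : n₁ < n₂) (hn₂ : n₂ < 2) (ha : 0 ≤ a) (hb : 0 ≤ b)
    (hab : a + b = 1) (hβh₁ : 0 ≤ βh₁) (h0₁ : βh₁ ≤ β₀) (hq : 1 < q)
    (hC₀ : Real.log (2 + 2 * q) - Real.log q * n₂ ≤ C₀) (hC₁ : 2 * Real.log q / Δ ≤ C₁) (hβh₂ : C₁ ≤ βh₂) (h0₂ : βh₂ ≤ β₀)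
    (hβ₀ : β₀ ≤ β) (hβ₀pos : 0 < β₀) {L₁ L₂ G₁ G₂ F₁ Q₁ : ℝ → ℝ}
    (hC : ∀ s ∈ Icc s₁ s₂, ∀ U ∈ Icc U₁ U₂, energyDensityTT' t s U (a * n₁ + b * n₂) ≤ c₀ + cs * s + c₁ * U)
    (hL₁ : ∀ s ∈ Icc s₁ s₂, L₁ s ≤ energyDensityTT' t s U₁ n₂) (hL₂ : ∀ s ∈ Icc s₁ s₂, L₂ s ≤ energyDensityTT' t s U₂ n₂)
    (hG₁ : ∀ s ∈ Icc s₁ s₂, G₁ s ≤ energyDensityTT' t s (U₁ - Δ) n₂) (hG₂ : ∀ s ∈ Icc s₁ s₂, G₂ s ≤ energyDensityTT' t s (U₂ - Δ) n₂)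
    (hLG₁ : ∀ s ∈ Icc s₁ s₂, G₁ s ≤ L₁ s) (hLG₂ : ∀ s ∈ Icc s₁ s₂, G₂ s ≤ L₂ s)
    (hF₁ : ∀ s ∈ Icc s₁ s₂, ∀ U ∈ Icc U₁ U₂, F₁ s ≤ energyDensityTT' t s U n₁)
    (hπ₁ : ∀ s ∈ Icc s₁ s₂, ∀ U ∈ Icc U₁ U₂, pressureTT' βh₁ t s U n₁ ≤ Q₁ s)
    (hm₁ : ∀ s ∈ Icc s₁ s₂, 0 ≤ a * F₁ s + b * L₁ s - (c₀ + cs * s + c₁ * U₁))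
    (hm₂ : ∀ s ∈ Icc s₁ s₂, 0 ≤ a * F₁ s + b * L₂ s - (c₀ + cs * s + c₁ * U₂))
    (hg₁ : ∀ s ∈ Icc s₁ s₂,
      a * Q₁ s + βh₁ * (a * F₁ s) + b * (C₀ + C₁ * (L₁ s - G₁ s)) < β₀ * (a * F₁ s + b * L₁ s - (c₀ + cs * s + c₁ * U₁)))
    (hg₂ : ∀ s ∈ Icc s₁ s₂,
      a * Q₁ s + βh₁ * (a * F₁ s) + b * (C₀ + C₁ * (L₂ s - G₂ s)) < β₀ * (a * F₁ s + b * L₂ s - (c₀ + cs * s + c₁ * U₂)))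
    {s : ℝ} (hs : s ∈ Icc s₁ s₂) {U : ℝ} (hU : U ∈ Icc U₁ U₂)
    {ω₁ ω₂ : InfVolFermionState 2} (h₁ : ω₁.IsTranslationInvariant) (h₂ : ω₂.IsTranslationInvariant)
    (hρ₁ : 0 < ω₁.density) (hρ₁' : ω₁.density ≤ n₁) (hρ₂ : n₂ ≤ ω₂.density) (hρ₂' : ω₂.density < 2)
    {n : ℝ} (hn0 : 0 < n) (hn2 : n < 2) {lam : ℝ} (hl0 : 0 < lam) (hl1 : lam < 1) {Ls : ℕ → ℕ}
    (hLs : Tendsto Ls atTop atTop) :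
    ¬ (mix lam hl0.le hl1.le ω₁ ω₂).IsTorusLimitOfMixture (sectorGibbsCount n) (fun L => sectorGibbsWeightTT' β t s U n L)
      (fun L => sectorGibbsVectorTT' t s U n L) Ls := by
  have hn2' : 0 < n₂ := hn₁.trans_lt hn
  have hU₁ : 0 ≤ U₁ := hU₁Δ.trans (by linarith)
  have hβ0pos : 0 < β := hβ₀pos.trans_le hβ₀
  have hκ : 0 < Real.log q := Real.log_pos hq
  have hC₁pos : 0 < C₁ := lt_of_lt_of_le (div_pos (by linarith) hΔ) hC₁
  have hβh₂' : 0 ≤ βh₂ := hC₁pos.le.trans hβh₂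
  refine psT_not_thermal_mix_on_cell_of_fns_hotAnchorFn t hU₁ hβ0pos hn₁ hn hn₂ ha hb hab hβh₁ hβh₂' (h0₁.trans hβ₀)
    (h0₂.trans hβ₀) (C := fun s U => c₀ + cs * s + c₁ * U) (F₁ := fun s _ => F₁ s)
    (F₂ := fun s U => ((U₂ - U) * L₁ s + (U - U₁) * L₂ s) / (U₂ - U₁)) (P₁ := fun s _ => Q₁ s)
    (P₂ := fun s U => C₀ + C₁ * (((U₂ - U) * L₁ s + (U - U₁) * L₂ s) / (U₂ - U₁) - ((U₂ - U) * G₁ s + (U - U₁) * G₂ s) / (U₂ - U₁)) -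
      βh₂ * (((U₂ - U) * L₁ s + (U - U₁) * L₂ s) / (U₂ - U₁)))
    hC hF₁ (floor_on_cell_of_columnLaws t hn2'.le hn₂ hU₁ h12 hL₁ hL₂) hπ₁
    (doccAnchor_on_cell t hΔ hU₁Δ h12 hn2' hn₂ hq hC₀ hC₁ hβh₂ hL₁ hL₂ hG₁ hG₂ hLG₁ hLG₂)
    ?_ hs hU h₁ h₂ hρ₁ hρ₁' hρ₂ hρ₂' hn0 hn2 hl0 hl1 hLs
  intro s hs U hU
  have hd : (U₂ - U₁) ≠ 0 := (sub_pos.2 h12).ne'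
  have e₁ : a * Q₁ s + βh₁ * (a * F₁ s) + b * C₀ <
      β₀ * (a * F₁ s + b * L₁ s - (c₀ + cs * s + c₁ * U₁)) - b * (C₁ * (L₁ s - G₁ s)) := by
    have := hg₁ s hs; linarith
  have e₂ : a * Q₁ s + βh₁ * (a * F₁ s) + b * C₀ <
      β₀ * (a * F₁ s + b * L₂ s - (c₀ + cs * s + c₁ * U₂)) - b * (C₁ * (L₂ s - G₂ s)) := by
    have := hg₂ s hs; linarith
  have hchord := chord_gt_of_ends_gt h12 hU e₁ e₂
  have hid : ((U₂ - U) * (β₀ * (a * F₁ s + b * L₁ s - (c₀ + cs * s + c₁ * U₁)) - b * (C₁ * (L₁ s - G₁ s))) +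
        (U - U₁) * (β₀ * (a * F₁ s + b * L₂ s - (c₀ + cs * s + c₁ * U₂)) - b * (C₁ * (L₂ s - G₂ s)))) / (U₂ - U₁) =
      β₀ * (a * F₁ s + b * (((U₂ - U) * L₁ s + (U - U₁) * L₂ s) / (U₂ - U₁)) - (c₀ + cs * s + c₁ * U)) -
        b * (C₁ * (((U₂ - U) * L₁ s + (U - U₁) * L₂ s) / (U₂ - U₁) - ((U₂ - U) * G₁ s + (U - U₁) * G₂ s) / (U₂ - U₁))) := by
    field_simp
    ring
  rw [hid] at hchord
  have hge := chord_ge_of_ends_ge h12 hU (hm₁ s hs) (hm₂ s hs)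
  have hidM : ((U₂ - U) * (a * F₁ s + b * L₁ s - (c₀ + cs * s + c₁ * U₁)) +
        (U - U₁) * (a * F₁ s + b * L₂ s - (c₀ + cs * s + c₁ * U₂))) / (U₂ - U₁) =
      a * F₁ s + b * (((U₂ - U) * L₁ s + (U - U₁) * L₂ s) / (U₂ - U₁)) - (c₀ + cs * s + c₁ * U) := by
    field_simp
    ring
  rw [hidM] at hge
  have k := mul_le_mul_of_nonneg_right hβ₀ hge
  show a * Q₁ s + b * (C₀ + C₁ * (((U₂ - U) * L₁ s + (U - U₁) * L₂ s) / (U₂ - U₁) -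
      ((U₂ - U) * G₁ s + (U - U₁) * G₂ s) / (U₂ - U₁)) - βh₂ * (((U₂ - U) * L₁ s + (U - U₁) * L₂ s) / (U₂ - U₁))) +
      βh₁ * (a * F₁ s) + βh₂ * (b * (((U₂ - U) * L₁ s + (U - U₁) * L₂ s) / (U₂ - U₁))) <
    β * (a * F₁ s + b * (((U₂ - U) * L₁ s + (U - U₁) * L₂ s) / (U₂ - U₁)) - (c₀ + cs * s + c₁ * U))
  linarith

/-! ## §3 Above a column with the Mott anchor -/

/-- **ABOVE A COLUMN, MOTT-ANCHORED DENSE PARTNER, CAP AFFINE IN `(s, U)` WITH `c₁ ≥ 0`.** One column law `L(s) ≤ e(t, s, U₂, n₂)` (floor for every `U ≥ U₂`),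
one lagged column `G(s) ≤ e(t, s, U_l, n₂)` (`0 ≤ U_l < U₂`, `G ≤ L`); dilute floor / anchor as in §2; `C₀ ≥ log(2+2q) − n₂ log q`, `C₁ ≥ 2 log q/(U₂ − U_l)`,
`C₁ ≤ β_{h,2} ≤ β₀`; far-end (`U₃`) margin `≥ 0` and `a Q₁ + β_{h,1} a F₁ + b (C₀ + C₁ (L − G)) < β₀·(a F₁ + b L − (c₀ + c_s s + c₁ U₃))` for every `s`; conclusion
on `[s₁, s₂] × [U₂, U₃]` for every `β ≥ β₀`. [cite: Israel1979, Thm. I.2.4] [cite: Griffiths1966, §II] [cite: Lieb1973, §V (5.2)–(5.4)] -/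
theorem psT_not_thermal_mix_above_column_doccAnchor_tcap (t : ℝ)
    {s₁ s₂ U₂ U₃ Ul n₁ n₂ a b c₀ cs c₁ β β₀ βh₁ βh₂ q C₀ C₁ : ℝ}
    (hUl : 0 ≤ Ul) (hUl₂ : Ul < U₂) (hc₁ : 0 ≤ c₁) (hn₁ : 0 ≤ n₁) (hn : n₁ < n₂) (hn₂ : n₂ < 2) (ha : 0 ≤ a) (hb : 0 ≤ b)
    (hab : a + b = 1) (hβh₁ : 0 ≤ βh₁) (h0₁ : βh₁ ≤ β₀) (hq : 1 < q)
    (hC₀ : Real.log (2 + 2 * q) - Real.log q * n₂ ≤ C₀) (hC₁ : 2 * Real.log q / (U₂ - Ul) ≤ C₁) (hβh₂ : C₁ ≤ βh₂) (h0₂ : βh₂ ≤ β₀)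
    (hβ₀ : β₀ ≤ β) (hβ₀pos : 0 < β₀) {L G F₁ Q₁ : ℝ → ℝ}
    (hC : ∀ s ∈ Icc s₁ s₂, ∀ U ∈ Icc U₂ U₃, energyDensityTT' t s U (a * n₁ + b * n₂) ≤ c₀ + cs * s + c₁ * U)
    (hL : ∀ s ∈ Icc s₁ s₂, L s ≤ energyDensityTT' t s U₂ n₂) (hG : ∀ s ∈ Icc s₁ s₂, G s ≤ energyDensityTT' t s Ul n₂)
    (hLG : ∀ s ∈ Icc s₁ s₂, G s ≤ L s)
    (hF₁ : ∀ s ∈ Icc s₁ s₂, ∀ U ∈ Icc U₂ U₃, F₁ s ≤ energyDensityTT' t s U n₁)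
    (hπ₁ : ∀ s ∈ Icc s₁ s₂, ∀ U ∈ Icc U₂ U₃, pressureTT' βh₁ t s U n₁ ≤ Q₁ s)
    (hm : ∀ s ∈ Icc s₁ s₂, 0 ≤ a * F₁ s + b * L s - (c₀ + cs * s + c₁ * U₃))
    (hg : ∀ s ∈ Icc s₁ s₂,
      a * Q₁ s + βh₁ * (a * F₁ s) + b * (C₀ + C₁ * (L s - G s)) < β₀ * (a * F₁ s + b * L s - (c₀ + cs * s + c₁ * U₃)))
    {s : ℝ} (hs : s ∈ Icc s₁ s₂) {U : ℝ} (hU : U ∈ Icc U₂ U₃)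
    {ω₁ ω₂ : InfVolFermionState 2} (h₁ : ω₁.IsTranslationInvariant) (h₂ : ω₂.IsTranslationInvariant)
    (hρ₁ : 0 < ω₁.density) (hρ₁' : ω₁.density ≤ n₁) (hρ₂ : n₂ ≤ ω₂.density) (hρ₂' : ω₂.density < 2)
    {n : ℝ} (hn0 : 0 < n) (hn2 : n < 2) {lam : ℝ} (hl0 : 0 < lam) (hl1 : lam < 1) {Ls : ℕ → ℕ}
    (hLs : Tendsto Ls atTop atTop) :
    ¬ (mix lam hl0.le hl1.le ω₁ ω₂).IsTorusLimitOfMixture (sectorGibbsCount n) (fun L => sectorGibbsWeightTT' β t s U n L)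
      (fun L => sectorGibbsVectorTT' t s U n L) Ls := by
  have hn2' : 0 < n₂ := hn₁.trans_lt hn
  have hU₂ : 0 ≤ U₂ := hUl.trans hUl₂.le
  have hβ0pos : 0 < β := hβ₀pos.trans_le hβ₀
  have hκ : 0 < Real.log q := Real.log_pos hq
  have hC₁pos : 0 < C₁ := lt_of_lt_of_le (div_pos (by linarith) (sub_pos.2 hUl₂)) hC₁
  have hβh₂' : 0 ≤ βh₂ := hC₁pos.le.trans hβh₂
  refine psT_not_thermal_mix_on_cell_of_fns_hotAnchorFn t hU₂ hβ0pos hn₁ hn hn₂ ha hb hab hβh₁ hβh₂' (h0₁.trans hβ₀)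
    (h0₂.trans hβ₀) (C := fun s U => c₀ + cs * s + c₁ * U) (F₁ := fun s _ => F₁ s) (F₂ := fun s _ => L s)
    (P₁ := fun s _ => Q₁ s) (P₂ := fun s _ => C₀ + C₁ * (L s - G s) - βh₂ * L s) hC hF₁
    (fun s hs U hU => floor_above_column_of_law t hn2'.le hn₂ hU₂ hL s hs U hU.1) hπ₁
    (doccAnchor_above_column t hUl hUl₂ hn2' hn₂ hq hC₀ hC₁ hβh₂ hL hG hLG)
    ?_ hs hU h₁ h₂ hρ₁ hρ₁' hρ₂ hρ₂' hn0 hn2 hl0 hl1 hLs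
  intro s hs U hU
  have k := mul_le_mul_of_nonneg_left hU.2 hc₁
  have hM3 := hm s hs
  have hM : a * F₁ s + b * L s - (c₀ + cs * s + c₁ * U₃) ≤ a * F₁ s + b * L s - (c₀ + cs * s + c₁ * U) := by linarith
  have hMU : 0 ≤ a * F₁ s + b * L s - (c₀ + cs * s + c₁ * U) := hM3.trans hM
  have k1 := mul_le_mul_of_nonneg_left hM hβ₀pos.le
  have k2 := mul_le_mul_of_nonneg_right hβ₀ hMU
  have hg' := hg s hs
  show a * Q₁ s + b * (C₀ + C₁ * (L s - G s) - βh₂ * L s) + βh₁ * (a * F₁ s) + βh₂ * (b * L s) <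
    β * (a * F₁ s + b * L s - (c₀ + cs * s + c₁ * U))
  linarith

end Summit.Ventures.CertifiedManyBodySolver.Observables

end
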